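import Mathlib.Algebra.Algebra.Equiv
import Mathlib.Algebra.MvPolynomial.Monad
import Mathlib.Algebra.MvPolynomial.Funext
import Mathlib.LinearAlgebra.Matrix.Permutation
import Literature.NumberTheory.Automorphic.HarishChandraGLSpan
import Literature.NumberTheory.Automorphic.HarishChandraGLModel
import HarnessLib

/-!
# Harish-Chandra parameters under the involution `θ(X) = -w₀ ᵗX w₀` of `𝔤𝔩ₙ(𝕜)`

Topic `NumberTheory/Automorphic`; theorems only (no definition, no named fact). `𝕜` is `ℝ` or `ℂ`
(`RCLike 𝕜`), `𝔤 = 𝔤𝔩ₙ(𝕜)` as a real Lie algebra, `U(𝔤) = UGL 𝕜 n` its real enveloping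
algebra, `Z(𝔤)` its centre, `HasHCParameter ρ χ` the accepted predicate of `HarishChandraGL`.
Companion of `HarishChandraGLTwist` (twisting by a character) and `HarishChandraGLConj` (complex
conjugate module): here the module `(V, ρ ∘ θ)` obtained by precomposing with the involutive Lie
algebra automorphism `θ(X) = -w₀ ᵗX w₀` (`w₀` the antidiagonal permutation matrix, i.e. the
permutation matrix of `Fin.rev`) — the differential of the outer automorphism `g ↦ w₀ ᵗg⁻¹ w₀` of
`GL_n` through which the CONTRAGREDIENT of an automorphic representation is realised on
`φ ↦ φ ∘ (g ↦ w₀ ᵗg⁻¹ w₀)` (Cogdell 2004, §2; the tree's `CuspidalContragredient*` series, where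
`θ` is `exists_lieHom_neg_weylLong_transpose`). The archimedean content of "the contragredient of
`π_∞` has Langlands parameter the inverse/dual parameter" (Knapp 2002, Thm. 5.44 with §V.5; Borel–
Wallach 2000, I §2; on `ℂˣ ⊆ W_ℂ`: `z^a z̄^b ↦ z^{-a} z̄^{-b}`) is:

* `HasHCParameter.comp_negRevTranspose` — **if `(V, ρ)` has Harish-Chandra parameter `χ`, then
  `(V, ρ ∘ θ)` has Harish-Chandra parameter `-χ`** (every entry negated, at every `τ`).
  Proof (as in `HarishChandraGLTwist`): `θ` extends to an algebra automorphism `A_θ` of `U(𝔤)`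
  (`exists_negRevTransposeHom`, an involution, hence preserving `Z(𝔤)`); `U(𝔤)` acts in `ρ ∘ θ`
  through `A_θ`, so the central character becomes `θ_V ∘ A_θ`; and for EVERY Harish-Chandra
  homomorphism `γ` (hypothesis structure `HarishChandraHomGL`), **`γ(A_θ z) = γ(z)(-x)`**
  (`HarishChandraHomGL.toAlgHom_negRevTranspose`): `θ` preserves `𝔫` and maps `diag(h)` to
  `-diag(h ∘ rev)`, so a highest weight vector of weight `λ` for `ρ_M` is one of weight
  `λ^θ_{τ,j} = -λ_{τ, rev j}` for `ρ_M ∘ θ`; comparing the scalars by which `z` acts on the highest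
  weight vectors of the model modules of `HarishChandraGLModel` (every weight occurs) gives
  `γ(A_θ z)(λ + ρ) = γ(z)(λ^θ + ρ)` with `(λ^θ + ρ)_{τ,j} = -(λ + ρ)_{τ, rev j}` (`ρ_{rev j} = -ρ_j`),
  i.e. `γ(A_θ z) = γ(z)(-x_{τ, rev j}) = γ(z)(-x)` by the `τ`-wise symmetry of `γ`.
* `exists_lieHom_negRevTranspose` — `θ` exists as a homomorphism of real Lie algebras;
  `negRevTranspose_apply` — its entries `(θ X)_{ij} = -X_{rev j, rev i}`.

All statements take any Lie algebra homomorphism `θ` with `θ X = -(P ᵗX P)`,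
`P = (Fin.revPerm).permMatrix 𝕜` (for the archimedean group of the `GL_n` datum this is the
coefficientwise form of `exists_lieHom_neg_weylLong_transpose`, `coe_weylLong`).

## References

* A. W. Knapp, *Lie Groups Beyond an Introduction*, 2nd ed. (2002), §V.5, Thm. 5.44. [Knapp2002]
* A. Borel, N. Wallach, *Continuous cohomology, discrete subgroups, and representations of
  reductive groups*, 2nd ed. (2000), I §2. [BorelWallach2000]
* J. W. Cogdell, *Analytic theory of L-functions for GL_n*, in: An Introduction to the Langlands
  Program (2004), §1 (after Thm. 1.2), §2. [CogdellAnalyticTheory2004]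
* J. Dixmier, *Enveloping Algebras* (1996), 2.1–2.2 (functoriality of `U`).
-/

-- Mathlib idiom (Mathlib/Algebra/Lie/OfAssociative.lean): the commutator bracket on matrices
attribute [local instance 100] LieRing.ofAssociativeRing

open scoped Matrix

noncomputable section

namespace Literature.NumberTheory.Automorphic

open UniversalEnvelopingAlgebra MvPolynomial HCSpan

variable {𝕜 : Type*} [RCLike 𝕜] {n : ℕ}

/-! ### The involution `θ(X) = -w₀ ᵗX w₀` of `𝔤𝔩ₙ(𝕜)` -/

section Theta

/-- Conjugating by the permutation matrix of `Fin.rev` reverses rows and columns: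
`(P M P)_{ij} = M_{rev i, rev j}`. [folklore] -/
theorem revPermMatrix_mul_mul_revPermMatrix_apply (M : Matrix (Fin n) (Fin n) 𝕜) (i j : Fin n) :
    ((Fin.revPerm.permMatrix 𝕜 : Matrix (Fin n) (Fin n) 𝕜) * M *
      (Fin.revPerm.permMatrix 𝕜 : Matrix (Fin n) (Fin n) 𝕜)) i j = M i.rev j.rev := by
  have h1 : (Fin.revPerm.permMatrix 𝕜 : Matrix (Fin n) (Fin n) 𝕜) * M = M.submatrix Fin.revPerm id :=
    PEquiv.toMatrix_toPEquiv_mul _ _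
  have h2 : M.submatrix Fin.revPerm id * (Fin.revPerm.permMatrix 𝕜 : Matrix (Fin n) (Fin n) 𝕜) =
      (M.submatrix Fin.revPerm id).submatrix id Fin.revPerm.symm :=
    PEquiv.mul_toMatrix_toPEquiv _ _
  rw [h1, h2]
  simp only [Matrix.submatrix_apply, id_eq, Fin.revPerm_symm, Fin.revPerm_apply]

/-- `P² = 1` for the permutation matrix `P` of `Fin.rev`. [folklore] -/
theorem revPermMatrix_mul_revPermMatrix :
    (Fin.revPerm.permMatrix 𝕜 : Matrix (Fin n) (Fin n) 𝕜) * (Fin.revPerm.permMatrix 𝕜) = 1 := by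
  have h : (Fin.revPerm : Equiv.Perm (Fin n)) * Fin.revPerm = 1 :=
    Equiv.ext fun i => by simp [Equiv.Perm.mul_apply]
  rw [← Matrix.permMatrix_mul, h, Matrix.permMatrix_one]

/-- **The involution `θ(X) = -w₀ ᵗX w₀` is a homomorphism of real Lie algebras** (minus the
transpose is a Lie algebra automorphism of `𝔤𝔩ₙ`, and so is conjugation by `w₀ = w₀⁻¹`): existence
as a `LieHom`. [folklore] -/
theorem exists_lieHom_negRevTranspose :
    ∃ θ : Matrix (Fin n) (Fin n) 𝕜 →ₗ⁅ℝ⁆ Matrix (Fin n) (Fin n) 𝕜, ∀ X,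
      θ X = -((Fin.revPerm.permMatrix 𝕜 : Matrix (Fin n) (Fin n) 𝕜) * Xᵀ *
        (Fin.revPerm.permMatrix 𝕜 : Matrix (Fin n) (Fin n) 𝕜)) := by
  set w : Matrix (Fin n) (Fin n) 𝕜 := Fin.revPerm.permMatrix 𝕜 with hw
  have hww : ∀ M : Matrix (Fin n) (Fin n) 𝕜, w * (w * M) = M := fun M => by
    rw [← Matrix.mul_assoc, hw, revPermMatrix_mul_revPermMatrix, Matrix.one_mul]
  refine ⟨{ toFun := fun X => -(w * Xᵀ * w)
            map_add' := fun X Y => by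
              rw [Matrix.transpose_add, Matrix.mul_add, Matrix.add_mul, neg_add]
            map_smul' := fun c X => by
              rw [Matrix.transpose_smul, Matrix.mul_smul, Matrix.smul_mul, smul_neg, RingHom.id_apply]
            map_lie' := fun {X Y} => ?_ }, fun X => rfl⟩
  rw [LieRing.of_associative_ring_bracket, LieRing.of_associative_ring_bracket, Matrix.transpose_sub,
    Matrix.transpose_mul, Matrix.transpose_mul, neg_mul_neg, neg_mul_neg]
  simp only [Matrix.mul_sub, Matrix.sub_mul, Matrix.mul_assoc, hww, neg_sub]

variable (θ : Matrix (Fin n) (Fin n) 𝕜 →ₗ⁅ℝ⁆ Matrix (Fin n) (Fin n) 𝕜)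
  (hθ : ∀ X, θ X = -((Fin.revPerm.permMatrix 𝕜 : Matrix (Fin n) (Fin n) 𝕜) * Xᵀ *
    (Fin.revPerm.permMatrix 𝕜 : Matrix (Fin n) (Fin n) 𝕜)))
include hθ

/-- Entries of `θ X`: `(θ X)_{ij} = -X_{rev j, rev i}`. [folklore] -/
theorem negRevTranspose_apply (X : Matrix (Fin n) (Fin n) 𝕜) (i j : Fin n) :
    θ X i j = -X j.rev i.rev := by
  rw [hθ, Matrix.neg_apply, revPermMatrix_mul_mul_revPermMatrix_apply, Matrix.transpose_apply]

/-- `θ` is an involution. [folklore] -/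
theorem negRevTranspose_negRevTranspose (X : Matrix (Fin n) (Fin n) 𝕜) : θ (θ X) = X := by
  ext i j
  rw [negRevTranspose_apply θ hθ, negRevTranspose_apply θ hθ, Fin.rev_rev, Fin.rev_rev, neg_neg]

/-- `θ` preserves the strictly upper triangular subalgebra `𝔫` (`ᵗ` sends it to the strictly lower
one, `w₀ · w₀` back). [folklore] -/
theorem negRevTranspose_mem_upperNilpLie {X : Matrix (Fin n) (Fin n) 𝕜} (hX : X ∈ upperNilpLie 𝕜 n) :
    θ X ∈ upperNilpLie 𝕜 n := by
  rw [mem_upperNilpLie_iff] at hX ⊢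
  intro i j hji
  rw [negRevTranspose_apply θ hθ, hX j.rev i.rev (Fin.rev_le_rev.2 hji), neg_zero]

/-- `θ (diag h) = -diag(h ∘ rev)`. [folklore] -/
theorem negRevTranspose_diagonal (h : Fin n → 𝕜) :
    θ (Matrix.diagonal h) = Matrix.diagonal fun i => -h i.rev := by
  ext i j
  rw [negRevTranspose_apply θ hθ, Matrix.diagonal_apply, Matrix.diagonal_apply]
  by_cases hij : i = j
  · subst hij; rw [if_pos rfl, if_pos rfl]
  · rw [if_neg (fun h' => hij (Fin.rev_injective h').symm), if_neg hij, neg_zero]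

omit hθ in
/-- The weight of `-diag(h ∘ rev)` for `λ` is the weight of `diag h` for
`λ^θ_{τ,j} = -λ_{τ, rev j}`. [folklore] -/
theorem weightFun_neg_comp_rev (l : ArchWeightGL 𝕜 n) (h : Fin n → 𝕜) :
    weightFun l (fun i => -h i.rev) = weightFun (fun τ j => -l τ j.rev) h := by
  unfold weightFun
  refine Finset.sum_congr rfl fun τ _ => ?_
  rw [← Equiv.sum_comp Fin.revPerm]
  refine Finset.sum_congr rfl fun i _ => ?_
  simp only [Fin.revPerm_apply, Fin.rev_rev, map_neg, mul_neg, neg_mul]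

/-- **Highest weight vectors for `ρ ∘ θ`**: a highest weight vector of weight `λ` for `ρ` is a
highest weight vector of weight `λ^θ_{τ,j} = -λ_{τ, rev j}` for `ρ' = ρ ∘ θ`. Knapp 2002, §V.5.
[folklore] -/
theorem IsHighestWeightVector.negRevTranspose {V : Type*} [AddCommGroup V] [Module ℂ V]
    {ρ ρ' : Matrix (Fin n) (Fin n) 𝕜 →ₗ⁅ℝ⁆ Module.End ℂ V} (hρ' : ∀ X, ρ' X = ρ (θ X))
    {l : ArchWeightGL 𝕜 n} {v : V} (hv : IsHighestWeightVector ρ l v) :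
    IsHighestWeightVector ρ' (fun τ j => -l τ j.rev) v := by
  refine ⟨hv.1, fun X hX => ?_, fun h => ?_⟩
  · rw [hρ', hv.2.1 _ (negRevTranspose_mem_upperNilpLie θ hθ hX)]
  · rw [hρ', negRevTranspose_diagonal θ hθ, hv.2.2, weightFun_neg_comp_rev]

end Theta

/-! ### The automorphism `A_θ` of `U(𝔤)` -/

section Lift

variable (θ : Matrix (Fin n) (Fin n) 𝕜 →ₗ⁅ℝ⁆ Matrix (Fin n) (Fin n) 𝕜)

/-- **Functoriality of `U`**: `θ` extends to an algebra endomorphism `A_θ` of `U(𝔤)` with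
`A_θ(X) = θ X` on `𝔤`. Dixmier, 2.1.1. [folklore] -/
theorem exists_negRevTransposeHom :
    ∃ A : UGL 𝕜 n →ₐ[ℝ] UGL 𝕜 n, ∀ X : Matrix (Fin n) (Fin n) 𝕜, A (ι ℝ X) = ι ℝ (θ X) :=
  ⟨lift ℝ ((ι ℝ).comp θ), fun X => by rw [lift_ι_apply]; rfl⟩

variable {θ}

/-- `A_θ ∘ A_θ = id` when `θ ∘ θ = id`. [folklore] -/
theorem negRevTransposeHom_comp_self (hθθ : ∀ X, θ (θ X) = X) {A : UGL 𝕜 n →ₐ[ℝ] UGL 𝕜 n}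
    (hA : ∀ X : Matrix (Fin n) (Fin n) 𝕜, A (ι ℝ X) = ι ℝ (θ X)) :
    A.comp A = AlgHom.id ℝ (UGL 𝕜 n) := by
  apply UniversalEnvelopingAlgebra.hom_ext
  refine LieHom.ext fun X => ?_
  simp only [LieHom.coe_comp, Function.comp_apply, AlgHom.coe_toLieHom, AlgHom.coe_comp,
    AlgHom.coe_id, id_eq]
  rw [hA, hA, hθθ]

/-- `A_θ` is surjective (an involution). [folklore] -/
theorem negRevTransposeHom_surjective (hθθ : ∀ X, θ (θ X) = X) {A : UGL 𝕜 n →ₐ[ℝ] UGL 𝕜 n}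
    (hA : ∀ X : Matrix (Fin n) (Fin n) 𝕜, A (ι ℝ X) = ι ℝ (θ X)) : Function.Surjective A := by
  have h := negRevTransposeHom_comp_self hθθ hA
  intro u
  exact ⟨A u, by rw [← AlgHom.comp_apply, h, AlgHom.coe_id, id_eq]⟩

/-- `A_θ` maps the centre `Z(𝔤)` into itself (it is surjective). [folklore] -/
theorem negRevTransposeHom_mem_center (hθθ : ∀ X, θ (θ X) = X) {A : UGL 𝕜 n →ₐ[ℝ] UGL 𝕜 n}
    (hA : ∀ X : Matrix (Fin n) (Fin n) 𝕜, A (ι ℝ X) = ι ℝ (θ X))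
    (z : Subalgebra.center ℝ (UGL 𝕜 n)) : A (z : UGL 𝕜 n) ∈ Subalgebra.center ℝ (UGL 𝕜 n) := by
  rw [Subalgebra.mem_center_iff]
  intro u
  obtain ⟨u', rfl⟩ := negRevTransposeHom_surjective hθθ hA u
  rw [← map_mul, ← map_mul, (Subalgebra.mem_center_iff.mp z.2) u']

variable {V : Type*} [AddCommGroup V] [Module ℂ V]

/-- **`U(𝔤)` acts in `ρ ∘ θ` through `A_θ`**: `lift (ρ ∘ θ) = lift ρ ∘ A_θ`. [folklore] -/
theorem lift_eq_lift_comp_negRevTransposeHom {A : UGL 𝕜 n →ₐ[ℝ] UGL 𝕜 n}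
    (hA : ∀ X : Matrix (Fin n) (Fin n) 𝕜, A (ι ℝ X) = ι ℝ (θ X))
    {ρ ρ' : Matrix (Fin n) (Fin n) 𝕜 →ₗ⁅ℝ⁆ Module.End ℂ V} (hρ' : ∀ X, ρ' X = ρ (θ X)) :
    lift ℝ ρ' = (lift ℝ ρ).comp A := by
  apply UniversalEnvelopingAlgebra.hom_ext
  refine LieHom.ext fun X => ?_
  simp only [LieHom.coe_comp, Function.comp_apply, AlgHom.coe_toLieHom, AlgHom.coe_comp]
  rw [lift_ι_apply, hρ', hA, lift_ι_apply]

/-- **Central character of `ρ ∘ θ`**: if `Z(𝔤)` acts in `ρ` by `θ_V`, it acts in `ρ ∘ θ` by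
`θ_V ∘ A_θ`. [folklore] -/
theorem HasCentralCharacter.negRevTranspose (hθθ : ∀ X, θ (θ X) = X) {A : UGL 𝕜 n →ₐ[ℝ] UGL 𝕜 n}
    (hA : ∀ X : Matrix (Fin n) (Fin n) 𝕜, A (ι ℝ X) = ι ℝ (θ X))
    {ρ ρ' : Matrix (Fin n) (Fin n) 𝕜 →ₗ⁅ℝ⁆ Module.End ℂ V} (hρ' : ∀ X, ρ' X = ρ (θ X))
    {θV : Subalgebra.center ℝ (UGL 𝕜 n) →ₐ[ℝ] ℂ} (hθV : HasCentralCharacter ρ θV) :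
    ∃ θV' : Subalgebra.center ℝ (UGL 𝕜 n) →ₐ[ℝ] ℂ, HasCentralCharacter ρ' θV' ∧
      ∀ z, θV' z = θV ⟨A z, negRevTransposeHom_mem_center hθθ hA z⟩ := by
  let A' : Subalgebra.center ℝ (UGL 𝕜 n) →ₐ[ℝ] Subalgebra.center ℝ (UGL 𝕜 n) :=
    (A.comp (Subalgebra.center ℝ (UGL 𝕜 n)).val).codRestrict (Subalgebra.center ℝ (UGL 𝕜 n))
      fun z => negRevTransposeHom_mem_center hθθ hA z
  refine ⟨θV.comp A', fun z => ?_, fun z => rfl⟩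
  rw [lift_eq_lift_comp_negRevTransposeHom hA hρ', AlgHom.comp_apply, AlgHom.comp_apply]
  exact hθV ⟨A z, negRevTransposeHom_mem_center hθθ hA z⟩

end Lift

/-! ### The Harish-Chandra polynomial of `A_θ z` -/

section HighestWeight

variable (θ : Matrix (Fin n) (Fin n) 𝕜 →ₗ⁅ℝ⁆ Matrix (Fin n) (Fin n) 𝕜)
  (hθ : ∀ X, θ X = -((Fin.revPerm.permMatrix 𝕜 : Matrix (Fin n) (Fin n) 𝕜) * Xᵀ *
    (Fin.revPerm.permMatrix 𝕜 : Matrix (Fin n) (Fin n) 𝕜)))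
include hθ

omit hθ in
/-- `ρ_{rev j} + ρ_j = 0`: the half-sum of positive roots is antisymmetric under `w₀`
(private copy of `ArchimedeanGLn.rhoGL_rev`, to keep the imports of this file at the level of
`HarishChandraGLTwist`). [folklore] -/
private theorem rhoGL_rev_add (j : Fin n) : rhoGL n j.rev + rhoGL n j = 0 := by
  have h : ((j.rev : ℕ) : ℂ) = (n : ℂ) - 1 - (j : ℕ) := by
    rw [Fin.val_rev]
    have hj : (j : ℕ) + 1 ≤ n := j.is_lt
    push_cast [Nat.cast_sub hj]
    ring
  simp only [rhoGL, h]
  ring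

/-- **The Harish-Chandra polynomial of `A_θ z`, first form**: for every Harish-Chandra homomorphism
`γ` and central `z`, `γ(A_θ z) = γ(z)(-x_{τ, rev j})` — both sides evaluated at every `λ + ρ` on the
highest weight vectors of the model modules (`HCModel.hwVec`), where `z` acts in `ρ_M ∘ θ` by
`γ(z)(λ^θ + ρ)` and `A_θ z` acts in `ρ_M` by `γ(A_θ z)(λ + ρ)`, and
`(λ^θ + ρ)_{τ,j} = -λ_{τ,rev j} + ρ_j = -(λ + ρ)_{τ, rev j}`. Knapp 2002, Thm. 5.44.
[cite: Knapp2002, §V.5 Thm. 5.44] -/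
theorem HarishChandraHomGL.toAlgHom_negRevTranspose_rev (γ : HarishChandraHomGL 𝕜 n)
    (hθθ : ∀ X, θ (θ X) = X) {A : UGL 𝕜 n →ₐ[ℝ] UGL 𝕜 n}
    (hA : ∀ X : Matrix (Fin n) (Fin n) 𝕜, A (ι ℝ X) = ι ℝ (θ X))
    (z : Subalgebra.center ℝ (UGL 𝕜 n)) :
    γ.toAlgHom ⟨A z, negRevTransposeHom_mem_center hθθ hA z⟩ =
      bind₁ (fun p : (𝕜 →ₐ[ℝ] ℂ) × Fin n => -X (p.1, p.2.rev)) (γ.toAlgHom z) := by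
  classical
  apply MvPolynomial.funext
  intro x
  -- the weight `l₀` with `x = l₀ + ρ`
  set l₀ : ArchWeightGL 𝕜 n := fun τ j => x (τ, j) - rhoGL n j with hl₀
  have hx : x = fun p : (𝕜 →ₐ[ℝ] ℂ) × Fin n => l₀ p.1 p.2 + rhoGL n p.2 := by
    funext p; simp [hl₀]
  -- the model module of weight `l₀` and its precomposition with `θ`
  have hv := HCModel.isHighestWeightVector_hwVec (𝕜 := 𝕜) l₀
  let ρ' : Matrix (Fin n) (Fin n) 𝕜 →ₗ⁅ℝ⁆ Module.End ℂ (HCModel.ModelSpace 𝕜 n) :=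
    (HCModel.modelRep 𝕜 n).rho.comp θ
  have hρ' : ∀ X, ρ' X = (HCModel.modelRep 𝕜 n).rho (θ X) := fun X => rfl
  have hv' := IsHighestWeightVector.negRevTranspose θ hθ hρ' hv
  -- `z` acts on the `θ`-model by `γ(z)(l₀^θ + ρ)`, and through `A_θ z` on the model
  have h1 := γ.highestWeight _ ρ' _ _ hv' z
  rw [lift_eq_lift_comp_negRevTransposeHom hA hρ', AlgHom.comp_apply] at h1
  have h2 := γ.highestWeight _ (HCModel.modelRep 𝕜 n).rho l₀ _ hv
    ⟨A z, negRevTransposeHom_mem_center hθθ hA z⟩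
  -- compare the two scalars and conclude pointwise
  have h3 := smul_left_injective ℂ (HCModel.hwVec_ne_zero l₀) (h2.symm.trans h1)
  have hfun : (fun p : (𝕜 →ₐ[ℝ] ℂ) × Fin n =>
      aeval (fun p : (𝕜 →ₐ[ℝ] ℂ) × Fin n => l₀ p.1 p.2 + rhoGL n p.2) (-X (p.1, p.2.rev) :
        MvPolynomial ((𝕜 →ₐ[ℝ] ℂ) × Fin n) ℂ)) =
      fun p : (𝕜 →ₐ[ℝ] ℂ) × Fin n => (fun τ j => -l₀ τ j.rev) p.1 p.2 + rhoGL n p.2 := by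
    funext p
    rw [map_neg, aeval_X]
    have := rhoGL_rev_add p.2
    linear_combination (-1 : ℂ) * this
  change aeval x _ = aeval x _
  rw [aeval_bind₁, hx, h3, hfun]

/-- **The Harish-Chandra polynomial of `A_θ z`**: `γ(A_θ z) = γ(z)(-x)` for every Harish-Chandra
homomorphism `γ` and central `z` (from the first form by the `τ`-wise symmetry of `γ(z)` under
`j ↦ rev j`). Knapp 2002, Thm. 5.44 (the infinitesimal character of the contragredient is
`χ ↦ -χ` up to the Weyl group). [cite: Knapp2002, §V.5 Thm. 5.44] -/
theorem HarishChandraHomGL.toAlgHom_negRevTranspose (γ : HarishChandraHomGL 𝕜 n)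
    (hθθ : ∀ X, θ (θ X) = X) {A : UGL 𝕜 n →ₐ[ℝ] UGL 𝕜 n}
    (hA : ∀ X : Matrix (Fin n) (Fin n) 𝕜, A (ι ℝ X) = ι ℝ (θ X))
    (z : Subalgebra.center ℝ (UGL 𝕜 n)) :
    γ.toAlgHom ⟨A z, negRevTransposeHom_mem_center hθθ hA z⟩ =
      bind₁ (fun p : (𝕜 →ₐ[ℝ] ℂ) × Fin n => -X p) (γ.toAlgHom z) := by
  rw [γ.toAlgHom_negRevTranspose_rev θ hθ hθθ hA z]
  conv_rhs => rw [← γ.symmetric (fun _ => Fin.revPerm) z]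
  rw [bind₁_rename]
  rfl

end HighestWeight

/-! ### Harish-Chandra parameters of `ρ ∘ θ` -/

section Parameters

variable {V : Type*} [AddCommGroup V] [Module ℂ V]
  (θ : Matrix (Fin n) (Fin n) 𝕜 →ₗ⁅ℝ⁆ Matrix (Fin n) (Fin n) 𝕜)
  (hθ : ∀ X, θ X = -((Fin.revPerm.permMatrix 𝕜 : Matrix (Fin n) (Fin n) 𝕜) * Xᵀ *
    (Fin.revPerm.permMatrix 𝕜 : Matrix (Fin n) (Fin n) 𝕜)))
include hθ

/-- **Harish-Chandra parameter of the precomposition with `θ(X) = -w₀ ᵗX w₀`.** If the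
`𝔤𝔩ₙ(𝕜)`-module `(V, ρ)` has Harish-Chandra parameter `χ`, then `(V, ρ ∘ θ)` (`ρ' X = ρ (θ X)`) has
Harish-Chandra parameter `τ ↦ -χ τ` (every entry negated). This is the archimedean half of
"the contragredient of an automorphic representation realised on `φ ∘ (g ↦ w₀ ᵗg⁻¹ w₀)`": on the
Langlands parameter restricted to `ℂˣ`, `(a_i, b_i) ↦ (-a_i, -b_i)`. Knapp 2002, Thm. 5.44;
Borel–Wallach 2000, I §2; Cogdell 2004, §2. [cite: Knapp2002, §V.5 Thm. 5.44] -/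
theorem HasHCParameter.comp_negRevTranspose
    {ρ ρ' : Matrix (Fin n) (Fin n) 𝕜 →ₗ⁅ℝ⁆ Module.End ℂ V} (hρ' : ∀ X, ρ' X = ρ (θ X))
    {χ : (𝕜 →ₐ[ℝ] ℂ) → Multiset ℂ} (hχ : HasHCParameter ρ χ) :
    HasHCParameter ρ' fun τ => (χ τ).map Neg.neg := by
  have hθθ : ∀ X, θ (θ X) = X := negRevTranspose_negRevTranspose θ hθ
  obtain ⟨hcard, θV, hθV, hθχ⟩ := hχ
  obtain ⟨A, hA⟩ := exists_negRevTransposeHom θ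
  obtain ⟨θV', hθV', hθV'θV⟩ := HasCentralCharacter.negRevTranspose hθθ hA hρ' hθV
  refine ⟨fun τ => by rw [Multiset.card_map, hcard], θV', hθV', fun γ l' hl' z => ?_⟩
  -- enumerate `χ` by `l = -l'`
  have hl : ∀ τ, Finset.univ.val.map (fun i => -l' τ i) = χ τ := fun τ => by
    have e : (fun i => -l' τ i) = Neg.neg ∘ l' τ := rfl
    rw [e, ← Multiset.map_map, hl', Multiset.map_map]
    simp only [Function.comp_def, neg_neg, Multiset.map_id']
  have hfun : (fun p : (𝕜 →ₐ[ℝ] ℂ) × Fin n =>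
      aeval (fun p : (𝕜 →ₐ[ℝ] ℂ) × Fin n => -l' p.1 p.2)
        (-X p : MvPolynomial ((𝕜 →ₐ[ℝ] ℂ) × Fin n) ℂ)) =
      fun p : (𝕜 →ₐ[ℝ] ℂ) × Fin n => l' p.1 p.2 := by
    funext p
    rw [map_neg, aeval_X, neg_neg]
  rw [hθV'θV z, hθχ γ (fun τ i => -l' τ i) hl ⟨A z, negRevTransposeHom_mem_center hθθ hA z⟩,
    γ.toAlgHom_negRevTranspose θ hθ hθθ hA z, aeval_bind₁, hfun]

end Parameters

end Literature.NumberTheory.Automorphic
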